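import Literature.Analysis.FluidPDE.SereginSverakAxisDecay
import Literature.Analysis.FluidPDE.SereginSverakBlowupDecay
import Literature.Analysis.FluidPDE.SereginSverakBlowupCompactnessProofs
import Literature.Analysis.FluidPDE.SereginSverakInteriorContinuity
import HarnessLib

/-!
# Seregin–Šverák 2009, Lemma 3.6 in its two renderings, and Theorem 3.2 conditional on the catalogued inputs

G. Seregin, V. Šverák, *On Type I singularities of the local axi-symmetric solutions of the
Navier–Stokes equations*, Comm. PDE 34 (2009), 171–201 = arXiv:0804.1803 (labels and pages are
those of the arXiv version). Companion (proofs file) of `SereginSverakAxisDecay.lean`, which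
vendors hypothesis (r4) of Thm. 3.2, Lemma 3.6 in the form `ScaledEnergyBoundOfAxisDecay` (one
function `Φ(C, ∫_Q |v|³, ∫_Q |q|^{3/2})` bounding `A + E + C + D` at the axis centres
`z_b = (b e₃, 0)`), and the assembly of Thm. 3.2 from Lemma 3.6, the blow-up alternative
`BlowupAlternative` of §4 (`SereginSverakAxisymmetric.lean`) and KNSS 2009, Thm. 5.3
(`isRegularAtOrigin_of_axisDecay_of_blowupAlternative`).

## What is proved here

* `scaledEnergyBoundOfAxisDecay_of_bound36`: the tree's other rendering of Lemma 3.6,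
  `ScaledEnergyBound36` of `SereginSverakBlowupDecay.lean` ("for all numbers `C, N₁, N₂` one
  constant `C₁` for every pair with `|x'| ‖u‖ ≤ C`, `∫_Q |u|³ ≤ N₁`, `∫_Q |p|^{3/2} ≤ N₂`"), implies
  `ScaledEnergyBoundOfAxisDecay` (take `Φ(C, I₃, I_{3/2}) = C₁(C, I₃, I_{3/2})`).
* `isRegularAtOrigin_of_axisDecay_of_facts`: Theorem 3.2 conditional on exactly the named facts
  behind the printed §4 — the uniform Lemma 3.6 (`ScaledEnergyBound36`), interior continuity of
  bounded solutions (`NSBoundedInteriorContinuity`, §2 p. 8 / App. II), the uniform local Hölder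
  bound on the blow-up sequence (`LocalHolderBound`, step (iv) of §4: [LSU] + [S8] + the parabolic
  embedding) — and KNSS 2009, Thm. 5.3: the blow-up alternative is the accepted
  `blowupAlternative_of_facts : ScaledEnergyBound36 → InteriorContinuity → BlowupCompactness →
  BlowupAlternative` (`SereginSverakBlowupDecay.lean`), fed into
  `isRegularAtOrigin_of_axisDecay_of_blowupAlternative` of the statement file.

## Why Thm. 3.2 has no blow-up fact of its own (review of 2026-08-15)

Until 2026-08-15 the statement file carried a second named fact: the blow-up step of §4
specialised to the hypotheses of Thm. 3.2, with Lemma 3.6 (`ScaledEnergyBoundOfAxisDecay`) as an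
antecedent. It was merged back into `BlowupAlternative`, of which its consequent is a corollary
(Lemma 3.6 at `b = 0` is the origin-centred local (p1) of `BlowupAlternative`, (r4) is its local
(p2) on `Q(1)`), because the antecedent carried no weight in any discharge. Step (iv) of §4
(arXiv p. 11, "`‖F^k‖_{3/2,Q(4a)} ≤ c₁(a)`") needs the pressure functional
`D((x_{3k} e₃, t_k), a λ_k; q)` bounded UNIFORMLY in `k` at the moving blow-up centres, `t_k ↑ 0`.
Under (r2) + (r4) this comes from Lemma 3.6 applied to the time-shifted zooms
`(s, y) ↦ (θ v, θ² q)(t_k + θ² s, θ y)`, whose norms `∫_Q |v_k|³ = C((t_k, 0), θ; v)`,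
`∫_Q |q_k|^{3/2} = D((t_k, 0), θ; q)` vary with `k` (they are bounded by `θ⁻² ∫_Q |v|³`,
`θ⁻² ∫_Q |q|^{3/2}`). With `ScaledEnergyBound36` a bound on the norms is a bound on `C₁`; with
`ScaledEnergyBoundOfAxisDecay`, whose `Φ` is an arbitrary function (its docstring: "monotonicity /
continuity of `Φ` is not printed and not assumed"), the numbers `Φ(C, C((t_k,0),θ;v), D((t_k,0),θ;q))`
need not stay bounded along the sequence, and no choice of the free parameters (the constant
`C' ≥ C` fed to (r4), the zoom `θ`, a shift along the axis, a time shift within `O(λ_k²)` of `t_k`)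
repairs this for every `Φ`. Comparing with time-`0` centres instead costs the factor
`1 + |t_k| M_k² / a²`, which only the Type I bound controls (`BlowupAlternativeTypeI`,
`SereginSverakBlowup.lean`). So the `∃ Φ` antecedent contributes only Lemma 3.6 at the ORIGIN,
i.e. the hypothesis (p1) of `BlowupAlternative`, and the blow-up step for Thm. 3.2 is discharged
exactly as `BlowupAlternative` is: from the uniform Lemma 3.6 (`ScaledEnergyBound36`),
`InteriorContinuity` and `BlowupCompactness` (`blowup_of_decay`, `blowupAlternative_of_facts`). §4
is one argument for Thms. 3.1 and 3.2; the tree keeps it once (`BlowupAlternative`), plus the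
Type I rendering `BlowupAlternativeTypeI` whose moving-centre bounds come from Lemma 3.5 inside
one solution.

## References

* G. Seregin, V. Šverák, Comm. PDE 34 (2009), 171–201, arXiv:0804.1803: §3 p. 9 (Thm. 3.2 (rt2),
  (r2), (r4)), pp. 9–10 (Lemma 3.5 (asl4) with (as4)–(as5), Lemma 3.6 (asl5)), §4 p. 11
  ((p1)–(p12)). [`SereginSverak2009`]
* G. Koch, N. Nadirashvili, G. Seregin, V. Šverák, Acta Math. 203 (2009), 83–105, Thm. 5.3.
  [`KochNadirashviliSereginSverak2009`]
-/

noncomputable section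

open MeasureTheory Set Function Filter Topology TopologicalSpace
open scoped NNReal ENNReal

namespace Literature.Analysis.FluidPDE

namespace SereginSverak2009

/-! ### The two renderings of Lemma 3.6 -/

/-- **Lemma 3.6, uniform-constant form ⇒ `Φ`-form.** `ScaledEnergyBound36` (for all `C, N₁, N₂`
one constant `C₁` valid for every pair under the hypotheses of Thm. 3.2 with `|x'| ‖u‖ ≤ C` a.e.,
`∫_Q |u|³ ≤ N₁`, `∫_Q |p|^{3/2} ≤ N₂`) implies `ScaledEnergyBoundOfAxisDecay`: put
`Φ(C, I₃, I_{3/2}) := C₁(C, I₃, I_{3/2})` (real parts of the finite integrals) and apply it to the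
pair's own norms. [cite: SereginSverak2009, Lemma 3.6 (asl5) with (as4)–(as5) (arXiv pp. 9–10)] -/
theorem scaledEnergyBoundOfAxisDecay_of_bound36 (h36 : ScaledEnergyBound36) :
    ScaledEnergyBoundOfAxisDecay := by
  choose C₁ hC₁ using h36
  refine ⟨fun C I J => C₁ C I.toReal J.toReal, fun u p C hsol hb hC => ?_⟩
  have hI : ∫⁻ z in parCyl 0 1, ‖u z.1 z.2‖ₑ ^ (3 : ℕ) ≤
      ENNReal.ofReal (∫⁻ z in parCyl 0 1, ‖u z.1 z.2‖ₑ ^ (3 : ℕ)).toReal := by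
    rw [ENNReal.ofReal_toReal hsol.velocity_L3.ne]
  have hJ : ∫⁻ z in parCyl 0 1, ‖p z.1 z.2‖ₑ ^ (3 / 2 : ℝ) ≤
      ENNReal.ofReal (∫⁻ z in parCyl 0 1, ‖p z.1 z.2‖ₑ ^ (3 / 2 : ℝ)).toReal := by
    rw [ENNReal.ofReal_toReal hsol.pressure_L32.ne]
  exact hC₁ C _ _ u p hsol hb hC hI hJ

/-! ### Theorem 3.2, conditional on the catalogued inputs -/

/-- **Seregin–Šverák 2009, Theorem 3.2, conditional on the catalogued named facts** — the uniform
Lemma 3.6 (`ScaledEnergyBound36`), interior continuity (`NSBoundedInteriorContinuity`), the local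
Hölder bound on the blow-up sequence (`LocalHolderBound`) and KNSS 2009, Thm. 5.3
(`KNSS2009_liouville_bound_C_over_r`): an axially symmetric distributional solution in `Q` with
`u ∈ L³(Q)`, `p ∈ L^{3/2}(Q)`, (r2) and (r4) is regular at the origin. Assembled as
`isRegularAtOrigin_of_axisDecay_of_blowupAlternative` of the statement file, Lemma 3.6 in its `∃ Φ`
form being fed by `scaledEnergyBoundOfAxisDecay_of_bound36` and the blow-up alternative of §4 by
the accepted `blowupAlternative_of_facts` (`SereginSverakBlowupDecay.lean`: near-maximum selection,
axis-centred rescaling, the pressure bound at the moving centres from the uniform Lemma 3.6 applied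
to the time-shifted zooms, and the compactness (p5)–(p11)) with `interiorContinuity_of` and
`blowupCompactness_of_localHolderBound`.
[cite: SereginSverak2009, Thm. 3.2 and §4 (arXiv pp. 9, 11)] -/
theorem isRegularAtOrigin_of_axisDecay_of_facts (h36 : ScaledEnergyBound36)
    (hIC : NSBoundedInteriorContinuity) (hLHB : LocalHolderBound)
    (h53 : KNSS2009_liouville_bound_C_over_r)
    {u : ℝ → EuclideanSpace ℝ (Fin 3) → EuclideanSpace ℝ (Fin 3)}
    {p : ℝ → EuclideanSpace ℝ (Fin 3) → ℝ} (hsol : IsAxisymmetricLocalSolution u p)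
    (hb : IsBoundedAwayFromZero u)
    (hd : IsAxisDecayOnCyl u) : IsRegularAtOrigin u :=
  isRegularAtOrigin_of_axisDecay_of_blowupAlternative (scaledEnergyBoundOfAxisDecay_of_bound36 h36)
    (blowupAlternative_of_facts h36 (interiorContinuity_of hIC)
      (blowupCompactness_of_localHolderBound hLHB)) h53 hsol hb hd

end SereginSverak2009

end Literature.Analysis.FluidPDE
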